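import Mathlib
import HarnessLib
import Summits.ValiantsHypothesis.ValiantsHypothesis.Theorems.LacunarySymmetroidMatrixDescartesProductPlusOneSeparatingWeightUpperSigned

/-!
# ValiantsHypothesis / LacunarySymmetroid — crux `MatrixDescartes` (stmt-ValiantsHypothesis-18050, V1),
# LINE (A) «product_plus_one»: the MIXED mean-ordered sector — upper-signed AND one-signed rows, EVERY `K`, every support

Every-`K` twin of ✓ `…ProductPlusOneSeparatingWeightMixed` (K = 3), on top of ✓ `…SeparatingWeightMeanPivot` / `…UpperSigned`.
At the bottom coupling (`d l₀ < d l` for `l ≠ l₀`) a ONE-SIGNED row (`a_{jl} > 0` for all `l`) never vanishes, has a POSITIVE stripped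
row `B_j = Σ_l (d_l − d_{l₀}) a_{jl} x^{d_l}` and is separated by the pivot `μ` iff its tilted gap-mean `B⁽²⁾_j/B_j` is `≤ μ` — exactly
like a SWITCHED upper-signed row.  Hence:

* `sepWeight_strippedRow_pos`, `sepWeight_oneSignedK_pos_roots` — positivity of the stripped row / no positive zero for one-signed rows;
* `sepWeight_mixedK_prod` — a company of upper-signed and one-signed rows has `P ≠ 0`, `Z₊(P) ≤ m`;
* ★★★ `sepWeight_meanOrdered_mixedK_le` — EVERY `K`, every support, bottom coupling: if at every `x > 0` the tilted gap-mean of every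
  one-signed row and of every switched upper-signed row is at most that of every unswitched upper-signed row, then
  `Z₊(eulerNumerator d a l₀) ≤ m + (m + 1)` — a linear, ratio-free row in the every-`K` twin of BOTH halves of the floor's open core
  («pullers at large ratio» and «pullers in company with one-signed rows»).

HONEST FRAMING: sector/helper theorems for the research stubs `stub_oneChangeFloorK3` / `stub_polyLaw`; NOT those stubs, not
`MatrixDescartes`; `VP ≠ VNP` is NOT proved.  No definitions, no named facts, no sorry.
-/

set_option linter.dupNamespace false

namespace Summit.ValiantsHypothesis.ValiantsHypothesis.Theorems.LacunarySymmetroidMatrixDescartes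

namespace ProductPlusOne

open Polynomial Finset
open scoped BigOperators

/-- the stripped letter row of a ONE-SIGNED row at the bottom coupling is POSITIVE on `(0,∞)`. [this file's lemma] -/
theorem sepWeight_strippedRow_pos {m K : ℕ} (d : Fin K → ℕ) (a : Fin m → Fin K → ℝ) (l₀ : Fin K)
    (hd : ∀ l, l ≠ l₀ → d l₀ < d l) (hK : ∃ l : Fin K, l ≠ l₀) (j : Fin m) (hpos : ∀ l, 0 < a j l) {z : ℝ} (hz : 0 < z) :
    0 < (∑ l, ((d l : ℝ) - d l₀) * a j l * z ^ (d l)) := by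
  classical
  obtain ⟨l₁, hl₁⟩ := hK
  have hterm : ∀ l ∈ Finset.univ.erase l₁, 0 ≤ ((d l : ℝ) - d l₀) * a j l * z ^ (d l) := by
    intro l _
    by_cases hl : l = l₀
    · subst hl; simp
    · have h1 : 0 < (d l : ℝ) - d l₀ := sub_pos.mpr (by exact_mod_cast hd l hl)
      have := hpos l
      positivity
  have hlt : 0 < ((d l₁ : ℝ) - d l₀) * a j l₁ * z ^ (d l₁) := by
    have h1 : 0 < (d l₁ : ℝ) - d l₀ := sub_pos.mpr (by exact_mod_cast hd l₁ hl₁)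
    have := hpos l₁
    positivity
  rw [← Finset.sum_erase_add _ _ (Finset.mem_univ l₁)]
  have := Finset.sum_nonneg hterm
  linarith

/-- a ONE-SIGNED fewnomial row has no positive zero and is not the zero polynomial. [this file's lemma] -/
theorem sepWeight_oneSignedK_pos_roots {K : ℕ} (d : Fin K → ℕ) (b : Fin K → ℝ) (hK : 0 < K) (hb : ∀ l, 0 < b l) :
    (∑ l, C (b l) * X ^ (d l) : ℝ[X]) ≠ 0 ∧
    ((∑ l, C (b l) * X ^ (d l) : ℝ[X]).roots.toFinset.filter (fun t => 0 < t)).card = 0 := by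
  classical
  have hne : (∑ l, C (b l) * X ^ (d l) : ℝ[X]) ≠ 0 := by
    intro h0
    have h := congrArg (Polynomial.eval 1) h0
    rw [eval_fewnomial, eval_zero] at h
    have : 0 < ∑ l, b l * (1 : ℝ) ^ (d l) :=
      Finset.sum_pos (fun l _ => by have := hb l; positivity) ⟨⟨0, hK⟩, Finset.mem_univ _⟩
    linarith
  refine ⟨hne, ?_⟩
  rw [Finset.card_eq_zero, Finset.filter_eq_empty_iff]
  intro x hx hxpos
  rw [Multiset.mem_toFinset, mem_roots hne, IsRoot.def, eval_fewnomial] at hx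
  have : 0 < ∑ l, b l * x ^ (d l) :=
    Finset.sum_pos (fun l _ => by have := hb l; positivity) ⟨⟨0, hK⟩, Finset.mem_univ _⟩
  linarith

/-- **The product of a mixed company** (each row upper-signed against the coupled letter, or one-signed): non-zero, `Z₊ ≤ m`.
[this file's lemma] -/
theorem sepWeight_mixedK_prod {m K : ℕ} (d : Fin K → ℕ) (a : Fin m → Fin K → ℝ) (l₀ : Fin K)
    (hd : ∀ l, l ≠ l₀ → d l₀ < d l)
    (hrows : ∀ j, (0 < a j l₀ ∧ ∀ l, l ≠ l₀ → a j l < 0) ∨ (∀ l, 0 < a j l)) :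
    (∏ j, ∑ l, C (a j l) * X ^ (d l) : ℝ[X]) ≠ 0 ∧ ((∏ j, ∑ l, C (a j l) * X ^ (d l) : ℝ[X]).roots.toFinset.filter (fun t => 0 < t)).card ≤ m := by
  classical
  have hK : 0 < K := Fin.pos l₀
  have hrow : ∀ j, (∑ l, C (a j l) * X ^ (d l) : ℝ[X]) ≠ 0 ∧
      (((∑ l, C (a j l) * X ^ (d l) : ℝ[X]).roots.toFinset.filter (fun t => 0 < t)).card ≤ 1) := by
    intro j
    rcases hrows j with h | h
    · have h1 := sepWeight_upperSigned_prod d (fun (_ : Fin 1) => a j) l₀ hd (fun _ => h)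
      simp only [Finset.univ_unique, Finset.prod_singleton] at h1
      exact ⟨h1.1, h1.2⟩
    · have h1 := sepWeight_oneSignedK_pos_roots d (a j) hK h
      exact ⟨h1.1, by rw [h1.2]; exact Nat.zero_le _⟩
  have hP0 : (∏ j, ∑ l, C (a j l) * X ^ (d l) : ℝ[X]) ≠ 0 := Finset.prod_ne_zero_iff.mpr (fun j _ => (hrow j).1)
  refine ⟨hP0, ?_⟩
  have hsub : ((∏ j, ∑ l, C (a j l) * X ^ (d l) : ℝ[X]).roots.toFinset.filter (fun t => 0 < t)) ⊆ Finset.univ.biUnion (fun j =>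
        ((∑ l, C (a j l) * X ^ (d l) : ℝ[X]).roots.toFinset.filter (fun t => 0 < t))) := by
    intro x hx
    rw [mem_filter, Multiset.mem_toFinset, mem_roots hP0, IsRoot.def, eval_prod, Finset.prod_eq_zero_iff] at hx
    obtain ⟨⟨j, _, hj⟩, hx0⟩ := hx
    rw [mem_biUnion]
    refine ⟨j, mem_univ _, ?_⟩
    rw [mem_filter, Multiset.mem_toFinset, mem_roots (hrow j).1, IsRoot.def]
    exact ⟨hj, hx0⟩
  refine (card_le_card hsub).trans (card_biUnion_le.trans ?_)
  calc ∑ j, (((∑ l, C (a j l) * X ^ (d l) : ℝ[X]).roots.toFinset.filter (fun t => 0 < t))).card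
      ≤ ∑ _j : Fin m, 1 := Finset.sum_le_sum (fun j _ => (hrow j).2)
    _ = m := by simp

/-- ★★★ **THE MIXED MEAN-ORDERED SECTOR, EVERY `K`** (bottom coupling `d l₀ < d l` for `l ≠ l₀`, some `l ≠ l₀`; each row either
upper-signed against the coupled letter — `a_{j l₀} > 0`, `a_{jl} < 0` otherwise — or one-signed — `a_{jl} > 0` for all `l`).  If at every
`x > 0`, for every row `j` that is one-signed or switched upper-signed (`f_j(x) < 0`) and every unswitched upper-signed row `i`
(`f_i(x) > 0`), the tilted gap-means satisfy `B⁽²⁾_j/B_j ≤ B⁽²⁾_i/B_i`, then `Z₊(eulerNumerator d a l₀) ≤ m + (m + 1)`.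
[this file's theorem] -/
theorem sepWeight_meanOrdered_mixedK_le {m K : ℕ} (d : Fin K → ℕ) (a : Fin m → Fin K → ℝ) (l₀ : Fin K)
    (hd : ∀ l, l ≠ l₀ → d l₀ < d l) (hK : ∃ l : Fin K, l ≠ l₀)
    (hrows : ∀ j, (0 < a j l₀ ∧ ∀ l, l ≠ l₀ → a j l < 0) ∨ (∀ l, 0 < a j l))
    (hord : ∀ z : ℝ, 0 < z → ∀ j i,
      ((∀ l, 0 < a j l) ∨ (∑ l, a j l * z ^ (d l)) < 0) → (∀ l, l ≠ l₀ → a i l < 0) → 0 < (∑ l, a i l * z ^ (d l)) → (∑ l, ((d l : ℝ) - d l₀) ^ 2 * a j l * z ^ (d l)) / (∑ l, ((d l : ℝ) - d l₀) * a j l * z ^ (d l)) ≤ (∑ l, ((d l : ℝ) - d l₀) ^ 2 * a i l * z ^ (d l)) / (∑ l, ((d l : ℝ) - d l₀) * a i l * z ^ (d l))) :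
    ((∑ j, (∑ l, C (a j l * ((d l : ℝ) - d l₀)) * X ^ (d l)) * ∏ i ∈ Finset.univ.erase j, (∑ l, C (a i l) * X ^ (d l)) : ℝ[X]).roots.toFinset.filter (fun t => 0 < t)).card ≤ m + (m + 1) := by
  classical
  obtain ⟨hP0, hZ⟩ := sepWeight_mixedK_prod d a l₀ hd hrows
  refine sepWeight_meanPivot_eulerNumerator_le d a l₀ hP0 m hZ (fun z hz hg _hEz => ?_)
  -- sign of the stripped row: negative for upper-signed rows, positive for one-signed rows
  have hBneg : ∀ j, (0 < a j l₀ ∧ ∀ l, l ≠ l₀ → a j l < 0) → (∑ l, ((d l : ℝ) - d l₀) * a j l * z ^ (d l)) < 0 := fun j h =>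
    sepWeight_strippedRow_neg d (fun (_ : Fin 1) => a j) l₀ hd hK (fun _ => h) 0 hz
  have hBpos : ∀ j, (∀ l, 0 < a j l) → 0 < (∑ l, ((d l : ℝ) - d l₀) * a j l * z ^ (d l)) := fun j h =>
    sepWeight_strippedRow_pos d (fun (_ : Fin 1) => a j) l₀ hd hK 0 h hz
  have hBne : ∀ j, (∑ l, ((d l : ℝ) - d l₀) * a j l * z ^ (d l)) ≠ 0 := by
    intro j
    rcases hrows j with h | h
    · exact (hBneg j h).ne
    · exact (hBpos j h).ne'
  have hGpos : ∀ j, (∀ l, 0 < a j l) → 0 < (∑ l, a j l * z ^ (d l)) := fun j h =>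
    Finset.sum_pos (fun l _ => by have := h l; positivity) ⟨l₀, Finset.mem_univ _⟩
  -- «riser-like» rows at `z`: one-signed, or switched upper-signed
  set R : Finset (Fin m) := Finset.univ.filter (fun j => (∀ l, 0 < a j l) ∨ (∑ l, a j l * z ^ (d l)) < 0) with hR
  by_cases hRne : R.Nonempty
  · -- pivot = the LARGEST tilted mean among the riser-like rows
    obtain ⟨j₀, hj₀, hmax⟩ := R.exists_max_image (fun j => (∑ l, ((d l : ℝ) - d l₀) ^ 2 * a j l * z ^ (d l)) / (∑ l, ((d l : ℝ) - d l₀) * a j l * z ^ (d l))) hRne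
    have hj₀' : (∀ l, 0 < a j₀ l) ∨ (∑ l, a j₀ l * z ^ (d l)) < 0 := (Finset.mem_filter.mp hj₀).2
    refine ⟨(∑ l, ((d l : ℝ) - d l₀) ^ 2 * a j₀ l * z ^ (d l)) / (∑ l, ((d l : ℝ) - d l₀) * a j₀ l * z ^ (d l)), fun j => ⟨?_, hBne j⟩⟩
    rcases hrows j with h | h
    · -- upper-signed row
      have hBj := hBneg j h
      rcases lt_or_gt_of_ne (hg j) with hlt | hgt
      · -- switched: mean ≤ pivot, `B_j < 0`
        have hle : (∑ l, ((d l : ℝ) - d l₀) ^ 2 * a j l * z ^ (d l)) / (∑ l, ((d l : ℝ) - d l₀) * a j l * z ^ (d l)) ≤ (∑ l, ((d l : ℝ) - d l₀) ^ 2 * a j₀ l * z ^ (d l)) / (∑ l, ((d l : ℝ) - d l₀) * a j₀ l * z ^ (d l)) := hmax j (Finset.mem_filter.mpr ⟨Finset.mem_univ _, Or.inr hlt⟩)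
        have h1 : (∑ l, ((d l : ℝ) - d l₀) ^ 2 * a j₀ l * z ^ (d l)) / (∑ l, ((d l : ℝ) - d l₀) * a j₀ l * z ^ (d l)) * (∑ l, ((d l : ℝ) - d l₀) * a j l * z ^ (d l)) ≤ (∑ l, ((d l : ℝ) - d l₀) ^ 2 * a j l * z ^ (d l)) := (div_le_iff_of_neg hBj).mp hle
        nlinarith
      · -- unswitched: the order hypothesis against `j₀` gives pivot ≤ mean_j, `B_j < 0`
        have hle : (∑ l, ((d l : ℝ) - d l₀) ^ 2 * a j₀ l * z ^ (d l)) / (∑ l, ((d l : ℝ) - d l₀) * a j₀ l * z ^ (d l)) ≤ (∑ l, ((d l : ℝ) - d l₀) ^ 2 * a j l * z ^ (d l)) / (∑ l, ((d l : ℝ) - d l₀) * a j l * z ^ (d l)) := hord z hz j₀ j hj₀' h.2 hgt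
        have h1 : (∑ l, ((d l : ℝ) - d l₀) ^ 2 * a j l * z ^ (d l)) ≤ (∑ l, ((d l : ℝ) - d l₀) ^ 2 * a j₀ l * z ^ (d l)) / (∑ l, ((d l : ℝ) - d l₀) * a j₀ l * z ^ (d l)) * (∑ l, ((d l : ℝ) - d l₀) * a j l * z ^ (d l)) := (le_div_iff_of_neg hBj).mp hle
        nlinarith
    · -- one-signed row: mean ≤ pivot, `B_j > 0`, `f_j > 0`
      have hBj := hBpos j h
      have hGj := hGpos j h
      have hle : (∑ l, ((d l : ℝ) - d l₀) ^ 2 * a j l * z ^ (d l)) / (∑ l, ((d l : ℝ) - d l₀) * a j l * z ^ (d l)) ≤ (∑ l, ((d l : ℝ) - d l₀) ^ 2 * a j₀ l * z ^ (d l)) / (∑ l, ((d l : ℝ) - d l₀) * a j₀ l * z ^ (d l)) := hmax j (Finset.mem_filter.mpr ⟨Finset.mem_univ _, Or.inl h⟩)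
      have h1 : (∑ l, ((d l : ℝ) - d l₀) ^ 2 * a j l * z ^ (d l)) ≤ (∑ l, ((d l : ℝ) - d l₀) ^ 2 * a j₀ l * z ^ (d l)) / (∑ l, ((d l : ℝ) - d l₀) * a j₀ l * z ^ (d l)) * (∑ l, ((d l : ℝ) - d l₀) * a j l * z ^ (d l)) := (div_le_iff₀ hBj).mp hle
      nlinarith
  · -- no riser-like row: every row is unswitched upper-signed; pivot = the SMALLEST tilted mean
    rcases Nat.eq_zero_or_pos m with hm | hm
    · subst hm
      exact ⟨0, fun j => j.elim0⟩
    obtain ⟨j₁, -, hmin⟩ := Finset.univ.exists_min_image (fun j => (∑ l, ((d l : ℝ) - d l₀) ^ 2 * a j l * z ^ (d l)) / (∑ l, ((d l : ℝ) - d l₀) * a j l * z ^ (d l))) ⟨⟨0, hm⟩, Finset.mem_univ _⟩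
    refine ⟨(∑ l, ((d l : ℝ) - d l₀) ^ 2 * a j₁ l * z ^ (d l)) / (∑ l, ((d l : ℝ) - d l₀) * a j₁ l * z ^ (d l)), fun j => ⟨?_, hBne j⟩⟩
    have hnot : ¬ ((∀ l, 0 < a j l) ∨ (∑ l, a j l * z ^ (d l)) < 0) := fun h => hRne ⟨j, Finset.mem_filter.mpr ⟨Finset.mem_univ _, h⟩⟩
    have h : 0 < a j l₀ ∧ ∀ l, l ≠ l₀ → a j l < 0 := by
      rcases hrows j with h | h
      · exact h
      · exact absurd (Or.inl h) hnot
    have hBj := hBneg j h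
    have hgt : 0 < (∑ l, a j l * z ^ (d l)) := by
      rcases lt_or_gt_of_ne (hg j) with hlt | hgt
      · exact absurd (Or.inr hlt) hnot
      · exact hgt
    have hle : (∑ l, ((d l : ℝ) - d l₀) ^ 2 * a j₁ l * z ^ (d l)) / (∑ l, ((d l : ℝ) - d l₀) * a j₁ l * z ^ (d l)) ≤ (∑ l, ((d l : ℝ) - d l₀) ^ 2 * a j l * z ^ (d l)) / (∑ l, ((d l : ℝ) - d l₀) * a j l * z ^ (d l)) := hmin j (Finset.mem_univ _)
    have h1 : (∑ l, ((d l : ℝ) - d l₀) ^ 2 * a j l * z ^ (d l)) ≤ (∑ l, ((d l : ℝ) - d l₀) ^ 2 * a j₁ l * z ^ (d l)) / (∑ l, ((d l : ℝ) - d l₀) * a j₁ l * z ^ (d l)) * (∑ l, ((d l : ℝ) - d l₀) * a j l * z ^ (d l)) := (le_div_iff_of_neg hBj).mp hle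
    nlinarith

end ProductPlusOne

end Summit.ValiantsHypothesis.ValiantsHypothesis.Theorems.LacunarySymmetroidMatrixDescartes
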